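import Literature.NumberTheory.GaloisRepresentations.SemiLocalUnitGroupUnramified
import Literature.NumberTheory.Automorphic.IdeleNormTowerProofs
import Literature.Algebra.Homology.GroupCohomologyPi
import Literature.Algebra.Homology.CohomologicalTrivialityTate
import Mathlib.FieldTheory.Galois.Basic
import HarnessLib

/-!
# Base change of the semi-local unit module along a tower `F ⊆ K ⊆ E`:
# `Res_{Gal(E/K)} ∏_{w ∣ v} 𝒪_wˣ = ∏_{v' ∣ v} ∏_{w ∣ v'} 𝒪_wˣ`, and **`U_E(v) = ∏_{w∣v} 𝒪_wˣ` is a cohomologically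
# trivial `Gal(E/F)`-module at a place `v` unramified in `E`** (Harari Prop. 8.3 / §13.1; Tate, C–F VII §7.3)

Topic `NumberTheory/GaloisRepresentations`; namespace `Literature.NumberTheory.GaloisRepresentations.SemiLocal`,
continuing `SemiLocalUnitGroupShapiro.lean` (`unitGroupRep F E v : Rep ℤ Gal(E/F)` on `∏_{w∣v} 𝒪_wˣ`) and
`SemiLocalUnitGroupUnramified.lean` (`isZero_groupCohomology_unitGroupRep'`: `Hⁿ(Gal(E/F), ∏_{w∣v} 𝒪_wˣ) = 0`, `n ≥ 1`,
`v` unramified — for the FULL group only).  Definitions with bodies and theorems; NO named fact, no `sorry`, no instance,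
no notation; number fields in `Type`.

Mathematics.  Harari's proof of Prop. 13.1 (b) [held copy p0204] uses that at an unramified place "`U_{K,v}` is a
cohomologically trivial `G_v`-module by Proposition 8.3", and Thm. 17.2 (the `P`-class formation `(G_S, C_S)`) needs
`U_S = ∏_{v ∉ S} U_K(v)` cohomologically trivial, i.e. `Ĥⁿ(U, ·) = 0` for EVERY subgroup `U ≤ G` and every
`n ∈ ℤ` (Serre IX §3).  For a subgroup `U = Gal(E/K)` (`K = E^U`) the `U`-module `∏_{w ∣ v} 𝒪_wˣ` (`w` places of
`E` over the place `v` of `F`) is the direct product over the places `v'` of `K` above `v` of the semi-local unit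
modules `∏_{w ∣ v'} 𝒪_wˣ` of the Galois extension `E/K` — the same completions `E_w`, the same automorphisms `σ_w`
(`galAdicCompletionMap (σ.restrictScalars F) = galAdicCompletionMap σ` definitionally) — and `v'` is unramified in
`E/K` when `v` is unramified in `E/F` (Mathlib `Algebra.IsUnramifiedAt.of_restrictScalars`).  Hence
`Hⁿ(U, ∏_{w∣v} 𝒪_wˣ) ≅ ∏_{v'∣v} Hⁿ(Gal(E/K), ∏_{w∣v'} 𝒪_wˣ) = 0` for `n ≥ 1` (the engine's `GroupCohomologyPi` and the
landed full-group vanishing for `E/K`), and the engine's criterion `isCohomologicallyTrivial_of_H1_H2` (Neukirch I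
(7.1) twin form: `H¹ = H² = 0` on all subgroups) gives cohomological triviality.

## What is formalised (`F K E : Type` number fields, `IsScalarTower F K E`, `v : HeightOneSpectrum (𝓞 F)`)

* §1 places in the tower: `Place.ofTower` (a place of `E` over `v' ∣ v` is over `v`), `Place.toTower` / `Place.overTower`
  (a place of `E` over `v` is over `w|_K ∣ v`), `isUnramifiedIn_tower`.
* §2 `towerRes v' : ∏_{w∣v} E_w →+* ∏_{w∣v'} E_w` (restriction of families), `towerRes_smul` (equivariance for
  `σ ∈ Gal(E/K)` acting through `σ.restrictScalars F`), `towerResUnits v'`, `towerResUnitGroup v'`.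
* §3 `unitGroupRepRes F K E v := Rep.res (restrictScalarsHom F) (unitGroupRep F E v)` (the `Gal(E/K)`-module
  `∏_{w∣v} 𝒪_wˣ`), the blocks `towerBlock v' : unitGroupRepRes ⟶ unitGroupRep K E v'`, **`towerBlock_bijective`**,
  `groupCohomologyResIso n : Hⁿ(Gal(E/K), ∏_{w∣v} 𝒪_wˣ) ≅ ∏_{v'∣v} Hⁿ(Gal(E/K), ∏_{w∣v'} 𝒪_wˣ)`,
  **`isZero_groupCohomology_unitGroupRepRes`** (`n ≥ 1`, `v` unramified in `E`).
* §4 subgroups: `isZero_groupCohomology_res_unitGroupRep` (`Hⁿ(U, ∏_{w∣v} 𝒪_wˣ) = 0` for EVERY `U ≤ Gal(E/F)`, `n ≥ 1`,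
  `v` unramified; transport along `U ≃* Gal(E/E^U)`, Mathlib `IntermediateField.fixingSubgroupEquiv`) and
  **`isCohomologicallyTrivial_unitGroupRep : IsCohomologicallyTrivial (unitGroupRep F E v)`** at an unramified `v`
  (Harari's "`U_{K,v}` is a cohomologically trivial `G_v`-module", in the semi-local `G`-module form used for `U_S`).

## References
* D. Harari, *Galois Cohomology and Class Field Theory*, Springer (2020), Prop. 8.3, §13.1 (proof of Prop. 13.1 (b)),
  §17.1 Thm. 17.2. [Harari2020]
* J. W. S. Cassels, A. Fröhlich (eds.), *Algebraic Number Theory* (1967), Ch. VII (Tate) §7.3 ("`∏_{v ∉ S} (∏_{w/v} U_w)`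
  has trivial cohomology if `S` contains all the ramified primes"). [CasselsFrohlichANT1967]
* J.-P. Serre, *Local Fields*, GTM 67 (1979), Ch. IX §3 (cohomologically trivial modules). [SerreLocalFields1979]
-/

noncomputable section

open NumberField IsDedekindDomain CategoryTheory CategoryTheory.Limits
open Literature.NumberTheory.Automorphic

namespace Literature.NumberTheory.GaloisRepresentations.SemiLocal

open Literature.Algebra.Homology

section Tower

variable {F K E : Type} [Field F] [Field K] [Field E] [NumberField F] [NumberField K] [NumberField E]
  [Algebra F K] [Algebra K E] [Algebra F E] [IsScalarTower F K E]
variable {v : HeightOneSpectrum (𝓞 F)}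

/-! ## §1. Places in the tower `F ⊆ K ⊆ E` -/

/-- A place of `E` above a place `v'` of `K` above `v` is above `v` (`(w ∩ 𝓞 K) ∩ 𝓞 F = w ∩ 𝓞 F`).
[cite: CasselsFrohlichANT1967, Ch. VII §1.1] -/
def Place.ofTower {v' : Place F K v} (w : Place K E (v' : HeightOneSpectrum (𝓞 K))) : Place F E v :=
  ⟨(w : HeightOneSpectrum (𝓞 E)), by
    rw [← HeightOneSpectrum.under_under F K E, w.under_eq, v'.under_eq]⟩

omit [NumberField F] [NumberField K] [NumberField E] in
/-- Underlying place of `Place.ofTower w` (definitional). [cite: CasselsFrohlichANT1967, Ch. VII §1.1] -/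
@[simp] theorem Place.coe_ofTower {v' : Place F K v} (w : Place K E (v' : HeightOneSpectrum (𝓞 K))) :
    ((Place.ofTower w : Place F E v) : HeightOneSpectrum (𝓞 E)) = (w : HeightOneSpectrum (𝓞 E)) := rfl

/-- The place `w ∩ 𝓞 K` of `K` below a place `w` of `E` above `v`; it is above `v`.
[cite: CasselsFrohlichANT1967, Ch. VII §1.1] -/
def Place.toTower (w : Place F E v) : Place F K v :=
  ⟨(w : HeightOneSpectrum (𝓞 E)).under (𝓞 K), by rw [HeightOneSpectrum.under_under F K E]; exact w.under_eq⟩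

/-- A place `w` of `E` above `v`, as a place above `w ∩ 𝓞 K`. [cite: CasselsFrohlichANT1967, Ch. VII §1.1] -/
def Place.overTower (w : Place F E v) : Place K E ((Place.toTower (K := K) w : Place F K v) : HeightOneSpectrum (𝓞 K)) :=
  ⟨(w : HeightOneSpectrum (𝓞 E)), rfl⟩

omit [NumberField F] [NumberField K] [NumberField E] in
/-- `ofTower (overTower w) = w`. [cite: CasselsFrohlichANT1967, Ch. VII §1.1] -/
@[simp] theorem Place.ofTower_overTower (w : Place F E v) : Place.ofTower (Place.overTower (K := K) w) = w :=
  Place.ext rfl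

omit [NumberField F] [NumberField K] [NumberField E] in
/-- `toTower (ofTower w) = v'` for `w` above `v'`. [cite: CasselsFrohlichANT1967, Ch. VII §1.1] -/
@[simp] theorem Place.toTower_ofTower {v' : Place F K v} (w : Place K E (v' : HeightOneSpectrum (𝓞 K))) :
    Place.toTower (K := K) (Place.ofTower w) = v' :=
  Place.ext w.under_eq

omit [NumberField F] [NumberField K] [NumberField E] in
/-- **A place unramified in `E/F` has all places of `K` above it unramified in `E/K`** (a prime of `𝓞 E` over `v'`
lies over `v`, and formal unramifiedness over `𝓞 F` implies it over `𝓞 K`, Mathlib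
`Algebra.IsUnramifiedAt.of_restrictScalars`). [cite: Harari2020, §13.1 (proof of Prop. 13.1 (b))] -/
theorem isUnramifiedIn_tower (hunr : Algebra.IsUnramifiedIn (𝓞 E) v.asIdeal) (v' : Place F K v) :
    Algebra.IsUnramifiedIn (𝓞 E) (v' : HeightOneSpectrum (𝓞 K)).asIdeal := by
  intro Q hQ hQv'
  haveI := hQ
  haveI := hQv'
  haveI : Q.LiesOver v.asIdeal := Ideal.LiesOver.trans Q (v' : HeightOneSpectrum (𝓞 K)).asIdeal v.asIdeal
  haveI : Algebra.IsUnramifiedAt (𝓞 F) Q := hunr Q hQ inferInstance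
  exact Algebra.IsUnramifiedAt.of_restrictScalars (𝓞 F) Q

/-! ## §2. Restriction of semi-local families to the places above one `v' ∣ v` -/

/-- **Restriction `∏_{w ∣ v} E_w → ∏_{w ∣ v'} E_w`** of a family indexed by the places of `E` above `v` to the places above
`v'` (`v' ∣ v` a place of `K`), a ring homomorphism. [cite: CasselsFrohlichANT1967, Ch. VII §7.3] -/
def towerRes (v' : Place F K v) : SemiLocal F E v →+* SemiLocal K E (v' : HeightOneSpectrum (𝓞 K)) :=
  RingHom.pi fun w => Pi.evalRingHom _ (Place.ofTower w)

omit [NumberField F] [NumberField K] in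
/-- Components of `towerRes`. [cite: CasselsFrohlichANT1967, Ch. VII §7.3] -/
@[simp] theorem towerRes_apply (v' : Place F K v) (x : SemiLocal F E v)
    (w : Place K E (v' : HeightOneSpectrum (𝓞 K))) : towerRes v' x w = x (Place.ofTower w) := rfl

omit [NumberField F] [NumberField K] [NumberField E] in
/-- `(σ.restrictScalars F)⁻¹ = σ⁻¹.restrictScalars F`. [folklore] -/
private theorem restrictScalars_inv (σ : E ≃ₐ[K] E) : (σ.restrictScalars F)⁻¹ = σ⁻¹.restrictScalars F :=
  (map_inv (AlgEquiv.restrictScalarsHom F : (E ≃ₐ[K] E) →* (E ≃ₐ[F] E)) σ).symm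

/-- **`towerRes` is `Gal(E/K)`-equivariant** for `Gal(E/K)` acting on `∏_{w∣v} E_w` through `σ ↦ σ.restrictScalars F`
(the transport maps `σ_w` are the same on both sides, and `σ` permutes the places above `v'`).
[cite: CasselsFrohlichANT1967, Ch. VII §1.1] -/
theorem towerRes_smul (v' : Place F K v) (σ : E ≃ₐ[K] E) (x : SemiLocal F E v) :
    towerRes v' ((σ.restrictScalars F) • x) = σ • towerRes v' x := by
  funext w
  have hw : ((σ.restrictScalars F)⁻¹ • Place.ofTower w : Place F E v) = Place.ofTower (σ⁻¹ • w) :=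
    Place.ext (by rw [restrictScalars_inv]; rfl)
  have h' : (σ.restrictScalars F) • ((Place.ofTower (σ⁻¹ • w) : Place F E v) : HeightOneSpectrum (𝓞 E)) =
      ((Place.ofTower w : Place F E v) : HeightOneSpectrum (𝓞 E)) := by
    rw [← hw]; exact Place.smul_coe_inv_smul _ _
  exact galAdicCompletionMap_congr_place hw (Place.smul_coe_inv_smul (σ.restrictScalars F) (Place.ofTower w)) h' x

/-- Restriction on units `(∏_{w∣v} E_w)ˣ →* (∏_{w∣v'} E_w)ˣ`. [cite: CasselsFrohlichANT1967, Ch. VII §7.3] -/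
def towerResUnits (v' : Place F K v) :
    (SemiLocal F E v)ˣ →* (SemiLocal K E (v' : HeightOneSpectrum (𝓞 K)))ˣ :=
  Units.map (towerRes v').toMonoidHom

omit [NumberField F] [NumberField K] in
/-- Components of `towerResUnits`. [cite: CasselsFrohlichANT1967, Ch. VII §7.3] -/
@[simp] theorem coe_towerResUnits_apply (v' : Place F K v) (u : (SemiLocal F E v)ˣ)
    (w : Place K E (v' : HeightOneSpectrum (𝓞 K))) :
    (towerResUnits v' u : SemiLocal K E (v' : HeightOneSpectrum (𝓞 K))) w =
      (u : SemiLocal F E v) (Place.ofTower w) := rfl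

omit [NumberField F] [NumberField K] in
/-- `towerRes` maps `∏_{w∣v} 𝒪_wˣ` into `∏_{w∣v'} 𝒪_wˣ`. [cite: CasselsFrohlichANT1967, Ch. VII §7.3] -/
theorem towerResUnits_mem_unitGroup (v' : Place F K v) {u : (SemiLocal F E v)ˣ} (hu : u ∈ unitGroup F E v) :
    towerResUnits v' u ∈ unitGroup K E (v' : HeightOneSpectrum (𝓞 K)) :=
  fun w => hu (Place.ofTower w)

/-- **Restriction on the unit groups `∏_{w∣v} 𝒪_wˣ →* ∏_{w∣v'} 𝒪_wˣ`.** [cite: CasselsFrohlichANT1967, Ch. VII §7.3] -/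
def towerResUnitGroup (v' : Place F K v) : unitGroup F E v →* unitGroup K E (v' : HeightOneSpectrum (𝓞 K)) :=
  ((towerResUnits v').comp (unitGroup F E v).subtype).codRestrict _ fun u =>
    towerResUnits_mem_unitGroup v' u.2

omit [NumberField F] [NumberField K] in
/-- Components of `towerResUnitGroup`. [cite: CasselsFrohlichANT1967, Ch. VII §7.3] -/
theorem coe_coe_towerResUnitGroup_apply (v' : Place F K v) (u : unitGroup F E v)
    (w : Place K E (v' : HeightOneSpectrum (𝓞 K))) :
    (((towerResUnitGroup v' u : unitGroup K E (v' : HeightOneSpectrum (𝓞 K))) :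
        (SemiLocal K E (v' : HeightOneSpectrum (𝓞 K)))ˣ) : SemiLocal K E (v' : HeightOneSpectrum (𝓞 K))) w =
      ((u : (SemiLocal F E v)ˣ) : SemiLocal F E v) (Place.ofTower w) := rfl

/-! ## §3. The `Gal(E/K)`-module `∏_{w ∣ v} 𝒪_wˣ` is the product of the `∏_{w ∣ v'} 𝒪_wˣ`, `v' ∣ v` -/

variable (F K E v) in
/-- **The semi-local unit module `U_E(v) = ∏_{w∣v} 𝒪_wˣ` as a `Gal(E/K)`-module**, by restriction along
`Gal(E/K) → Gal(E/F)`, `σ ↦ σ.restrictScalars F` (Mathlib `AlgEquiv.restrictScalarsHom`).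
[cite: Harari2020, §13.1 (the `G`-module `U_K(v)`)] -/
abbrev unitGroupRepRes : Rep ℤ (E ≃ₐ[K] E) :=
  Rep.res (AlgEquiv.restrictScalarsHom F : (E ≃ₐ[K] E) →* (E ≃ₐ[F] E)) (unitGroupRep F E v)

/-- **The block at `v' ∣ v`: `Res_{Gal(E/K)} ∏_{w∣v} 𝒪_wˣ ⟶ ∏_{w∣v'} 𝒪_wˣ`**, a morphism of `Gal(E/K)`-modules.
[cite: CasselsFrohlichANT1967, Ch. VII §7.3] -/
def towerBlock (v' : Place F K v) : unitGroupRepRes F K E v ⟶ unitGroupRep K E (v' : HeightOneSpectrum (𝓞 K)) :=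
  Rep.ofHom ⟨(MonoidHom.toAdditive (towerResUnitGroup v')).toIntLinearMap, fun σ => LinearMap.ext fun x => by
    apply Additive.toMul.injective
    apply Subtype.ext
    apply Units.ext
    exact towerRes_smul v' σ (((Additive.toMul x : unitGroup F E v) : (SemiLocal F E v)ˣ) : SemiLocal F E v)⟩

/-- Components of `towerBlock`. [cite: CasselsFrohlichANT1967, Ch. VII §7.3] -/
theorem coe_coe_towerBlock_apply (v' : Place F K v) (x : Additive (unitGroup F E v))
    (w : Place K E (v' : HeightOneSpectrum (𝓞 K))) :
    ((((Additive.toMul ((towerBlock v').hom x)) : unitGroup K E (v' : HeightOneSpectrum (𝓞 K))) :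
        (SemiLocal K E (v' : HeightOneSpectrum (𝓞 K)))ˣ) : SemiLocal K E (v' : HeightOneSpectrum (𝓞 K))) w =
      (((Additive.toMul x : unitGroup F E v) : (SemiLocal F E v)ˣ) : SemiLocal F E v) (Place.ofTower w) := rfl

/-- **`Res_{Gal(E/K)} ∏_{w∣v} 𝒪_wˣ = ∏_{v'∣v} ∏_{w∣v'} 𝒪_wˣ`**: the joint block map is bijective (every place of `E`
above `v` is above exactly one place of `K` above `v`). [cite: CasselsFrohlichANT1967, Ch. VII §7.3] -/
theorem towerBlock_bijective :
    Function.Bijective fun (x : unitGroupRepRes F K E v) (v' : Place F K v) => (towerBlock v').hom x := by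
  constructor
  · intro x y h
    apply Additive.toMul.injective
    refine Subtype.ext (Units.ext (funext fun w => ?_))
    have hw := congrFun h (Place.toTower (K := K) w)
    exact congrArg (fun u : Additive (unitGroup K E ((Place.toTower (K := K) w : Place F K v) :
        HeightOneSpectrum (𝓞 K))) =>
      (((Additive.toMul u : unitGroup K E _) : (SemiLocal K E ((Place.toTower (K := K) w : Place F K v) :
        HeightOneSpectrum (𝓞 K)))ˣ) : SemiLocal K E _) (Place.overTower (K := K) w)) hw
  · intro t
    -- the unit of `∏_{w∣v} E_w` with `w`-component the `w`-component of the block of `t` at `w|_K`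
    let u : (SemiLocal F E v)ˣ := MulEquiv.piUnits.symm fun w : Place F E v =>
      Units.map (Pi.evalMonoidHom (fun w' : Place K E ((Place.toTower (K := K) w : Place F K v) :
          HeightOneSpectrum (𝓞 K)) => (w' : HeightOneSpectrum (𝓞 E)).adicCompletion E) (Place.overTower (K := K) w))
        ((Additive.toMul (t (Place.toTower (K := K) w)) : unitGroup K E _) : (SemiLocal K E _)ˣ)
    have hu : u ∈ unitGroup F E v := fun w =>
      (mem_unitGroup_iff.mp (Additive.toMul (t (Place.toTower (K := K) w)) : unitGroup K E _).2)
        (Place.overTower (K := K) w)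
    refine ⟨(Additive.ofMul ⟨u, hu⟩ : Additive (unitGroup F E v)), funext fun v' => ?_⟩
    apply Additive.toMul.injective
    refine Subtype.ext (Units.ext (funext fun w => ?_))
    change (u : SemiLocal F E v) (Place.ofTower w) =
      (((Additive.toMul (t v') : unitGroup K E (v' : HeightOneSpectrum (𝓞 K))) :
        (SemiLocal K E (v' : HeightOneSpectrum (𝓞 K)))ˣ) : SemiLocal K E (v' : HeightOneSpectrum (𝓞 K))) w
    obtain ⟨v', hv'⟩ := v'
    obtain ⟨w, hw⟩ := w
    change HeightOneSpectrum.under (𝓞 K) w = v' at hw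
    subst hw
    rfl

/-- **`Hⁿ(Gal(E/K), ∏_{w∣v} 𝒪_wˣ) ≅ ∏_{v'∣v} Hⁿ(Gal(E/K), ∏_{w∣v'} 𝒪_wˣ)`** for every `n ≥ 0` (the engine's
`GroupCohomologyPi.piIso`). [cite: CasselsFrohlichANT1967, Ch. VII §7.3] -/
def groupCohomologyResIso (n : ℕ) :
    groupCohomology (unitGroupRepRes F K E v) n ≅
      @ModuleCat.of ℤ _ (∀ v' : Place F K v, groupCohomology (unitGroupRep K E (v' : HeightOneSpectrum (𝓞 K))) n) _
        (Pi.module _ _ ℤ) :=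
  GroupCohomologyPi.piIso towerBlock_bijective n

/-- **`Hⁿ(Gal(E/K), ∏_{w∣v} 𝒪_wˣ) = 0` for `n ≥ 1` at a place `v` of `F` unramified in `E`** (`E/K` Galois): each block
`∏_{w∣v'} 𝒪_wˣ` has `Hⁿ = 0` for the full group `Gal(E/K)` (`isZero_groupCohomology_unitGroupRep'` for `E/K`, `v'`
unramified by `isUnramifiedIn_tower`). [cite: Harari2020, §13.1 (proof of Prop. 13.1 (b))] -/
theorem isZero_groupCohomology_unitGroupRepRes [IsGalois K E] (hunr : Algebra.IsUnramifiedIn (𝓞 E) v.asIdeal)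
    (n : ℕ) [NeZero n] : IsZero (groupCohomology (unitGroupRepRes F K E v) n) :=
  GroupCohomologyPi.isZero_of_forall towerBlock_bijective n fun v' =>
    isZero_groupCohomology_unitGroupRep' (F := K) (E := E) (v' : HeightOneSpectrum (𝓞 K))
      (isUnramifiedIn_tower hunr v') n

end Tower

/-! ## §4. Every subgroup: cohomological triviality of `∏_{w ∣ v} 𝒪_wˣ` at an unramified place -/

section Subgroups

variable {F E : Type} [Field F] [Field E] [NumberField F] [NumberField E] [Algebra F E]
variable {v : HeightOneSpectrum (𝓞 F)}

/-- **`Hⁿ(U, ∏_{w∣v} 𝒪_wˣ) = 0` for EVERY subgroup `U ≤ Gal(E/F)`, every `n ≥ 1`, at a place `v` unramified in `E`**: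
`U = Gal(E/E^U)` (Mathlib `IntermediateField.fixingSubgroup_fixedField`, `fixingSubgroupEquiv`), transport by
`groupCohomology.mapIso`, and §3 for the tower `F ⊆ E^U ⊆ E`.
[cite: Harari2020, §13.1 (proof of Prop. 13.1 (b))][cite: CasselsFrohlichANT1967, Ch. VII §7.3] -/
theorem isZero_groupCohomology_res_unitGroupRep [IsGalois F E] (hunr : Algebra.IsUnramifiedIn (𝓞 E) v.asIdeal)
    (U : Subgroup (E ≃ₐ[F] E)) (n : ℕ) [NeZero n] :
    IsZero (groupCohomology (Rep.res U.subtype (unitGroupRep F E v)) n) := by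
  set K : IntermediateField F E := IntermediateField.fixedField U with hK
  have hU : K.fixingSubgroup = U := IntermediateField.fixingSubgroup_fixedField U
  let e : U ≃* (E ≃ₐ[K] E) :=
    (MulEquiv.subgroupCongr hU.symm).trans (IntermediateField.fixingSubgroupEquiv K)
  have iso : groupCohomology (Rep.res U.subtype (unitGroupRep F E v)) n ≅
      groupCohomology (unitGroupRepRes F K E v) n :=
    groupCohomology.mapIso e (LinearEquiv.refl ℤ _) (fun _ => rfl) n
  exact (isZero_groupCohomology_unitGroupRepRes (F := F) (K := K) (E := E) hunr n).of_iso iso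

/-- **`U_E(v) = ∏_{w ∣ v} 𝒪_wˣ` is a cohomologically trivial `Gal(E/F)`-module at a place `v` unramified in `E`**
(`Ĥⁿ(U, ∏_{w∣v} 𝒪_wˣ) = 0` for every subgroup `U` and every `n ∈ ℤ`; Harari: "`U_{K,v}` is a cohomologically trivial
`G_v`-module by Proposition 8.3", here for the semi-local `G`-module as needed for `U_S` in Thm. 17.2) — from `H¹ = H² = 0`
on all subgroups (the engine's `isCohomologicallyTrivial_of_H1_H2`).
[cite: Harari2020, §13.1 (proof of Prop. 13.1 (b))][cite: SerreLocalFields1979, Ch. IX §3] -/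
theorem isCohomologicallyTrivial_unitGroupRep [IsGalois F E] (hunr : Algebra.IsUnramifiedIn (𝓞 E) v.asIdeal) :
    IsCohomologicallyTrivial (unitGroupRep F E v) :=
  CohomologicalTriviality.isCohomologicallyTrivial_of_H1_H2 _
    (fun U => isZero_groupCohomology_res_unitGroupRep hunr U 1)
    (fun U => isZero_groupCohomology_res_unitGroupRep hunr U 2)

/-- **`Ĥⁿ(U, ∏_{w∣v} 𝒪_wˣ) = 0`** for every subgroup `U ≤ Gal(E/F)` and every `n ∈ ℤ` at a place unramified in `E`
(unfolding of cohomological triviality). [cite: Harari2020, §13.1 (proof of Prop. 13.1 (b))] -/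
theorem isZero_tateCohomology_res_unitGroupRep [IsGalois F E] (hunr : Algebra.IsUnramifiedIn (𝓞 E) v.asIdeal)
    (U : Subgroup (E ≃ₐ[F] E)) [Fintype U] (n : ℤ) :
    IsZero (tateCohomology (Rep.res U.subtype (unitGroupRep F E v)) n) :=
  isCohomologicallyTrivial_unitGroupRep hunr U n

end Subgroups

end Literature.NumberTheory.GaloisRepresentations.SemiLocal

end
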